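import Literature.MathematicalPhysics.QuantumFieldTheory.Balaban1983to89.B13JetFamilyLocality

/-!
# `Balaban1983to89.B13TermKernelsPullback` — T. Bałaban, *Renormalization group approach to lattice gauge field
theories. I*, Commun. Math. Phys. **109** (1987) 249–301 [Balaban1987RG1], (1.7) p. 261 and (2.27)(i) of *III* («it depends
on U_k restricted to X»), with *II. Cluster expansions*, CMP **116** (1988) [Balaban1988RG2Cluster], p. 13 ∕ p. 15, (2.14)–(2.16)
pp. 15–16, and [B9] = *Propagators for lattice gauge theories in a background field*, CMP **99** (1985)
[Balaban1985BackgroundPropagators], Thm 3.10 p. 416 («A term in this expansion, corresponding to a walk ω, depends on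
configuration U restricted to X̃₀⁵ ∪ X̃₁⁵ ∪ … ∪ X̃ₙ⁵»): **ENTRY-LEVEL (1.7)-LOCALITY HOLDS BY CONSTRUCTION FOR KERNEL DATA PULLED
BACK FROM THE WINDOW SPACE** — the pullback constructor `pullback 𝒦 r` of a term's kernel data `𝒦` on a window space `V`
along a continuous linear restriction `r : W →L[ℂ] V`, the transport of the walk objects (`JointWalkExpansion`,
`WalkMajorants`, `AnalyticOnBall`, `TermWalkData`, `Jet216R`) from `V` to the pullback, and the three entry-level locality
hypotheses `hEr` ∕ `hbd` ∕ `hfac` of `B13JetFamilyLocality` DISCHARGED for pullback families from the walk data on `V` alone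

statement-level skeleton of published theorems with citation tags; proofs where landed; nothing here is a claim about
the Yang–Mills mass gap

CITATION HEADER.  Cell `pub-balaban`, BINDER row (D4) OWNER lineage `b2b-balaban-beta-an4` (gen 119), objects-side junction
for the ideation cell `ym-nodeO-ideate`'s road «W-jet2» (P3 memo `ROUTE-P3.md` v3.28 §2; census C88; P3 g24 scratch n°36
`NodeO-jet-entrylocal-P3g24.lean`, 2026-08-26T10:50Z, which PACKAGES the residual price (r2) of the jet road after this
lineage's `B13Core214EntryHolomorphic` (p435418), `B13Term214JetAgreement` (p437107 ∕ p437879) and `B13JetFamilyLocality`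
(p437714) as `EntryLocal 𝒦 σ r ρ ρ' S := ∃ Er, (∀ i, DifferentiableOn ℂ (Er · i) (ball 0 ρ')) ∧ (∀ i, ∀ v ∈ ball 0 ρ',
‖Er v i‖ ≤ S) ∧ ∀ u ∈ ball 0 ρ, entries 𝒦 σ u = Er (r u)` and records it «NOT supplied here or anywhere in the tree»).
THE PRINT.  [I] p. 261 (1.7): the effective action is a sum of terms `E^{(j)}(X, U_j)` over localization domains `X ∈ 𝐃_j`, and
*"the term corresponding to a domain X depends on U_j restricted to X"*; [III] (2.27)(i) verbatim *"it depends on U_k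
restricted to X"*; [II] p. 13: the operators of one (2.14)-term are given by *"generalized random walk expansions … discussed in
[13]"* built on the term's localization domain, p. 15: they are *"analytic functions on the space of configurations (U, J)
satisfying the conditions I.(i)–(iii) on the domain Z, with constants α′₀, α′₁"*; [B9] Thm 3.10 p. 416: each walk's term is a
function of the configuration restricted to the cubes the walk visits.  In words: Bałaban's kernel data of a term ARE
functions on the configurations ON THE TERM'S DOMAIN, read on the full configuration space through the restriction map —
i.e. a PULLBACK.  This file types that reading and what it buys.

WHAT THIS FILE TYPES ∕ PROVES (all [folklore] bookkeeping over the tree's records; kernel-checked).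
§1 `pullback 𝒦 r` — DATA: the kernel data of a term on `W` obtained from kernel data `𝒦 : TermKernels c d N' ν Nf V` on a
   window space `V` by composing the precision `A(σ,·)` and the Γ-kernel `G(σ,·)` with `r : W →L[ℂ] V`; rows, columns,
   locations, σ-region, fibre bound and the REAL reference data `Γ₀`, `C` unchanged (`r 0 = 0`).  Definitional faces
   `pullback_A2` ∕ `pullback_G2` ∕ `entries_pullback` (`entries (pullback 𝒦 r) σ u = entries 𝒦 σ (r u)`, `rfl`).
§2 TRANSPORT OF THE WALK OBJECTS from `V` to the pullback along any `r` mapping the `R′`-ball of `W` into the `R`-ball of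
   `V` (`mapsTo_ball_of_opNorm_le`: a contraction `‖r‖ ≤ 1` with `R′ ≤ R`; coordinate restrictions in sup norms are
   contractions): `analyticOnBall_comp_clm`, `jointWalkExpansion_comp_clm` (same walks, terms `T_ω(σ, r ·)`, same
   amplitudes ∕ distances ∕ rates ∕ σ-structure), `walkMajorants_comp_clm`, `termWalkData_pullback` (package `{w with R := R′}`),
   `termWalkData_pullback_of_opNorm_le` (SAME package), `existsWalkDataUniform_pullback` (a member assembled term by term from
   window-space data with ONE package keeps that package), `jet216R_pullback` (the jet record of `NodeOJetFamily` with the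
   SAME seven letters along a contraction: chain rule for `fderiv`, this lineage's `mixedDeriv_comp_clm` for `∂²`).
§3 (r2) FOR PULLBACK FAMILIES — the three hypotheses of `B13JetFamilyLocality` §2–§3 DISCHARGED with `Er := entries 𝒦 σ`:
   `differentiableOn_entries` (`hEr` from `AnalyticOnBall` of `A2`, `G2` on `V`), `norm_entries_le` (`hbd` with
   `S = max K̄_Γ K̄_E` from the torus majorants, `κ ≥ 0`), `termWalkData_differentiableOn_entries` ∕
   `termWalkData_norm_entries_le` (both from `TermWalkData 𝒦 w` on the window space), and the headline
   **`entryLocal_pullback`**: `∃ Er, hEr ∧ hbd ∧ ∀ u : W, entries (pullback 𝒦 r) σ u = Er (r u)` — `hfac` on the WHOLE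
   space (hence on every ball: n°36's `EntryLocal (pullback 𝒦 r) σ r ρ w.R (max K̄_Γ K̄_E)` for every `ρ`), from
   `TermWalkData 𝒦 w` + the signs of an admissible package; `entryLocal_pullback_of_admissible`.
§4 CONSEQUENCES BY NAME (`B13JetFamilyLocality`): `entries_kjet_eq_jet2` (the jet family's entries ARE `jet2` of the
   entries, definitional), **`entries_kjet_pullback`** — THE JET LIFT COMMUTES WITH THE PULLBACK on the polydisc:
   `entries (kjet (pullback 𝒦 r)) σ u = entries (kjet 𝒦) σ (r u)` for every `u : W` (`entries_kjet_fac` with `hfac := rfl`),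
   `jet_object_fac_pullback` (every jet object factors through `r` EVERYWHERE with local factor `Φ ∘ entries (kjet 𝒦) σ` — the
   SAME object on the window space's jet family), `trueObject_fac_pullback` (the true object factors everywhere, `rfl`),
   `analyticAt_jetFactor_pullback` (the local factor is analytic at `0` on a finite-dimensional window space — Osgood, by
   name), and **`wallShapes_pullback`**: `∃ F, AnalyticAt ℂ F 0 ∧ ∀ u, Φ (entries (kjet (pullback 𝒦 r)) σ u) = F (r u)` — the
   conclusion of n°36's `wallShapes_of_entryLocal` (the (D4) wall's `hfac` ∕ `hF` shapes of `Beta.RemainderLocality.PolLeavesTFac`)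
   with NO locality hypothesis: walk data on the window space + `Φ` holomorphic near the base entries, nothing else.
READING (the point of the file, planning-grade): a producer of NODE O's objects who builds each term's `TermKernels` as
print does — operators defined on the configurations on the term's domain `X`, composed with the restriction `r_X` — meets
the jet road's residual (r2) AT ZERO COST beyond the walk data the «W-walks» rung already asks ON THE WINDOW SPACE (§2 then
transports those data to the full space with the same package); (r2) is not an independent price for print-shaped
producers.  For a producer whose kernels are NOT given as pullbacks, (r2) remains the hypothesis of `B13JetFamilyLocality`.
HONEST SCOPE.  One definition (`pullback`, DATA, nothing asserted) + [folklore] transport ∕ calculus lemmas over the tree's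
`TermKernels` ∕ `JointWalkExpansion` ∕ `TermWalkData` ∕ `Jet216R` ∕ `kjet` ∕ `entries` ∕ `jet2`; NOT asserted: that Bałaban's
`Γ_k(Z₀,σ)`, `Δ^{(k)}(Z₀,σ)`, `C^{(k)}(Z₀,σ)` admit walk data on the window spaces (NODE O ∕ NODE 00 content — [B9] Thm 3.10 in a
complex background with decoupling parameters, cell GAPS G-B9-10), or with which constants; no object of Bałaban's is
constructed; row (D4) instance 0∕1, T⁴ spine 0∕9 UNCHANGED; NOT NODE O, NOT [B12] Thm 2, NOT `BetaPertH`, NOT continuum, NOT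
mass gap, NOT Clay.  No `sorry`, no named fact, no instance, no notation.  HONEST DEPENDENCY (cell pub-balaban, verbatim):
continuum YM on T⁴ ⇐ BetaPertH ∧ nine spine estimates (0∕9 proved); BetaPertH ⇐ (D1) ∧ (D4) ∧ CAP+tail.
-/

noncomputable section

namespace Literature.MathematicalPhysics.QuantumFieldTheory.Balaban1983to89.B13TermKernelsPullback

open Metric Set Filter
open scoped Topology
open B13TermWalkData (TermKernels WalkConsts TermWalkData ExistsWalkDataUniform)
open B13JointWalkExpansion (JointWalkExpansion WalkMajorants)
open B9Thm37GlueTorus (tdist1 tdist1_nonneg)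
open TreeLengthTorus (TPt)
open B5TorusCover (UT)
open NodeOJetCalculus (jet2 jet2_zero)
open NodeOJetFamily (kjet entries Jet216R)
open B12Decay510 (mixedDeriv)
open Beta.RemainderLocality (mixedDeriv_comp_clm)
open B13JetFamilyLocality (entries_kjet_fac analyticAt_jetFactor)

variable {c : B13.Consts} {d N' ν : ℕ} {Nf : Fin ν → ℕ} [∀ i, NeZero (Nf i)]
variable {W V : Type*} [NormedAddCommGroup W] [NormedSpace ℂ W] [NormedAddCommGroup V] [NormedSpace ℂ V]

/-! ## §1 The pullback of a term's kernel data along a continuous linear restriction -/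

section Pullback

/-- **THE PULLBACK OF A TERM'S KERNEL DATA** from a window space `V` along `r : W →L[ℂ] V`: the precision and the Γ-kernel
are read through `r`, `A(σ,u) := A_V(σ, r u)`, `G(σ,u) := G_V(σ, r u)`; rows `Λ`, columns `Λ ⊕ C₀`, locations, σ-region
`X`, fibre bound and the real reference data `Γ₀ = G(0,0)`, `C = A(0,0)⁻¹ ≻ 0` are those of `𝒦` (`r 0 = 0`).  This is the
typed form of print's *"the term corresponding to a domain X depends on U_j restricted to X"*: the term's operators are
functions of the configuration ON `X`, read on the full configuration space through the restriction.  DATA; nothing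
asserted. [cite: Balaban1987RG1, (1.7) p.261, (1.18) p.263; Balaban1988RG2Cluster, p.13, (2.14)–(2.16) pp.15–16] -/
def pullback (𝒦 : TermKernels c d N' ν Nf V) (r : W →L[ℂ] V) : TermKernels c d N' ν Nf W where
  Λ := 𝒦.Λ
  C₀ := 𝒦.C₀
  A2 := fun σ u => 𝒦.A2 σ (r u)
  G2 := fun σ u => 𝒦.G2 σ (r u)
  Γ₀ := 𝒦.Γ₀
  C := 𝒦.C
  locΛ := 𝒦.locΛ
  locN := 𝒦.locN
  X := 𝒦.X
  m := 𝒦.m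
  hfib := 𝒦.hfib
  hG0 := by
    show 𝒦.G2 0 (r 0) = _
    rw [map_zero]; exact 𝒦.hG0
  hC0 := by
    show (𝒦.A2 0 (r 0))⁻¹ = _
    rw [map_zero]; exact 𝒦.hC0
  hC := 𝒦.hC

/-- The pullback's precision (definitional). [cite: Balaban1988RG2Cluster, (2.14)–(2.16) pp.15–16] -/
@[simp] theorem pullback_A2 (𝒦 : TermKernels c d N' ν Nf V) (r : W →L[ℂ] V) (σ : TPt d N' → ℂ) (u : W) :
    (pullback 𝒦 r).A2 σ u = 𝒦.A2 σ (r u) := rfl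

/-- The pullback's Γ-kernel (definitional). [cite: Balaban1988RG2Cluster, (2.14)–(2.16) pp.15–16] -/
@[simp] theorem pullback_G2 (𝒦 : TermKernels c d N' ν Nf V) (r : W →L[ℂ] V) (σ : TPt d N' → ℂ) (u : W) :
    (pullback 𝒦 r).G2 σ u = 𝒦.G2 σ (r u) := rfl

/-- **The entries of the pullback are the window-space entries read through `r`** — the `hfac` clause of entry-level
(1.7)-locality, on the WHOLE configuration space, by `rfl`. [cite: Balaban1987RG1, (1.7) p.261; Balaban1988RG2Cluster, (2.14)–(2.16) pp.15–16] -/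
theorem entries_pullback (𝒦 : TermKernels c d N' ν Nf V) (r : W →L[ℂ] V) (σ : TPt d N' → ℂ) (u : W) :
    entries (pullback 𝒦 r) σ u = entries 𝒦 σ (r u) := rfl

/-- At the base configuration the pullback's entries are the window-space base entries (`r 0 = 0`). [cite: Balaban1988RG2Cluster, (2.14)–(2.16) pp.15–16] -/
theorem entries_pullback_zero (𝒦 : TermKernels c d N' ν Nf V) (r : W →L[ℂ] V) (σ : TPt d N' → ℂ) :
    entries (pullback 𝒦 r) σ 0 = entries 𝒦 σ 0 := by
  rw [entries_pullback, map_zero]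

end Pullback

/-! ## §2 Transport of the walk objects from the window space to the pullback -/

section Transport

/-- A contraction maps the `R′`-ball of `W` into the `R`-ball of `V` when `R′ ≤ R` (coordinate restrictions in sup norms
are contractions) — the hypothesis shape `hr` of the transport lemmas below, served for the printed case (restriction of
a configuration to the cubes a walk visits). [folklore] [cite: Balaban1985BackgroundPropagators, Thm 3.10 p.416] -/
theorem mapsTo_ball_of_opNorm_le (r : W →L[ℂ] V) (hr : ‖r‖ ≤ 1) {R R' : ℝ} (hRR' : R' ≤ R) :
    MapsTo r (ball (0 : W) R') (ball (0 : V) R) := by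
  intro u hu
  rw [mem_ball_zero_iff] at hu ⊢
  calc ‖r u‖ ≤ ‖r‖ * ‖u‖ := r.le_opNorm u
    _ ≤ ‖u‖ := mul_le_of_le_one_left (norm_nonneg _) hr
    _ < R' := hu
    _ ≤ R := hRR'

/-- A contraction does not increase norms. [folklore] -/
private theorem norm_apply_le_of_opNorm_le (r : W →L[ℂ] V) (hr : ‖r‖ ≤ 1) (u : W) : ‖r u‖ ≤ ‖u‖ :=
  (r.le_opNorm u).trans (mul_le_of_le_one_left (norm_nonneg _) hr)

variable {p n : Type}

/-- **Entrywise analyticity on a ball transports along `r`**: if `u ↦ K(σ,u)(b,j)` is complex differentiable on the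
`R`-ball of `V` for every `σ` in the polydisc, then `u ↦ K(σ, r u)(b,j)` is so on every ball of `W` that `r` maps into it
(composition with a continuous linear map). [cite: Balaban1988RG2Cluster, p.15] -/
theorem analyticOnBall_comp_clm {K2 : (TPt d N' → ℂ) → V → Matrix p n ℂ} {R R' : ℝ}
    (h : JointWalkExpansion.AnalyticOnBall c K2 R) (r : W →L[ℂ] V)
    (hr : MapsTo r (ball (0 : W) R') (ball (0 : V) R)) :
    JointWalkExpansion.AnalyticOnBall c (fun σ u => K2 σ (r u)) R' :=
  fun σ hσ b j => (h σ hσ b j).comp r.differentiableOn hr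

variable {locp : p → UT Nf} {locn : n → UT Nf} {K2 : (TPt d N' → ℂ) → V → Matrix p n ℂ}
variable {X : Finset (UT Nf)} {R ε kap Kbar : ℝ}
variable {Ω : Type} {T2 : Ω → (TPt d N' → ℂ) → V → Matrix p n ℂ} {SX : Set Ω} {A : Ω → ℝ}
variable {D : Ω → UT Nf → UT Nf → ℝ} {ρ : ℝ}

/-- **A joint walk expansion on the window space pulls back to one on the full space** — SAME walks, terms
`T_ω(σ, r u)`, same amplitudes, walk distances, walk rate, rate drop, torus rate, majorant constant and σ-structure — on
any ball of `W` that `r` maps into the expansion's ball: `HasSum` and the uniform (3.108)-shape bounds are read at `r u`,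
termwise analyticity composes with `r`, the reference-configuration clauses use `r 0 = 0`, and the configuration-free
fields (`majSum`, `through`, signs) are untouched.  This is [B9] Thm 3.10's *"depends on configuration U restricted to
X̃₀⁵ ∪ … ∪ X̃ₙ⁵"* at the level of the whole expansion. [cite: Balaban1985BackgroundPropagators, Thm 3.10 p.416; Balaban1988RG2Cluster, p.13, p.15] -/
theorem jointWalkExpansion_comp_clm (h : JointWalkExpansion c locp locn K2 X R ε kap Kbar T2 SX A D ρ)
    (r : W →L[ℂ] V) {R' : ℝ} (hr : MapsTo r (ball (0 : W) R') (ball (0 : V) R)) :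
    JointWalkExpansion c locp locn (fun σ u => K2 σ (r u)) X R' ε kap Kbar (fun ω σ u => T2 ω σ (r u)) SX A D ρ where
  hasSum σ hσ u hu i j := h.hasSum σ hσ (r u) (hr hu) i j
  termAnalytic ω σ hσ i j := (h.termAnalytic ω σ hσ i j).comp r.differentiableOn hr
  maj ω σ hσ u hu i j := h.maj ω σ hσ (r u) (hr hu) i j
  majSum := h.majSum
  indep ω hω σ hσ := by
    show T2 ω σ (r 0) = T2 ω 0 (r 0)
    rw [map_zero]; exact h.indep ω hω σ hσ
  through := h.through
  A_nonneg := h.A_nonneg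
  D_nonneg := h.D_nonneg

/-- **Walk majorants on the window space pull back** (the covariance's weaker triple: expansion, uniform bounds,
full-rate `MajSumLe`). [cite: Balaban1985BackgroundPropagators, (3.108) p.416; Balaban1988RG2Cluster, p.13, p.15] -/
theorem walkMajorants_comp_clm (h : WalkMajorants c locp locn K2 R kap Kbar T2 A D ρ)
    (r : W →L[ℂ] V) {R' : ℝ} (hr : MapsTo r (ball (0 : W) R') (ball (0 : V) R)) :
    WalkMajorants c locp locn (fun σ u => K2 σ (r u)) R' kap Kbar (fun ω σ u => T2 ω σ (r u)) A D ρ where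
  hasSum σ hσ u hu i j := h.hasSum σ hσ (r u) (hr hu) i j
  maj ω σ hσ u hu i j := h.maj ω σ hσ (r u) (hr hu) i j
  majSum := h.majSum
  A_nonneg := h.A_nonneg

/-- **The three walk objects of a term with one package, on the window space, pull back to the three walk objects of the
pullback term** with the package `{w with R := R′}` for any `R′`-ball of `W` mapped by `r` into the `w.R`-ball of `V`; the
geometric clause `d₁(loc b, X) ≥ R_σ` is configuration-free. [cite: Balaban1988RG2Cluster, p.13, p.15, (2.16) p.16; Balaban1985BackgroundPropagators, Thm 3.10 p.416] -/
theorem termWalkData_pullback {𝒦 : TermKernels c d N' ν Nf V} {w : WalkConsts} (h : TermWalkData 𝒦 w)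
    (r : W →L[ℂ] V) {R' : ℝ} (hr : MapsTo r (ball (0 : W) R') (ball (0 : V) w.R)) :
    TermWalkData (pullback 𝒦 r) { w with R := R' } := by
  obtain ⟨ΩΓ, TΓ, SXΓ, AΓ, DΓ, ρΓ, hΓ⟩ := h.hΓ
  obtain ⟨ΩE, TE, SXE, AE, DE, ρE, hE⟩ := h.hE
  obtain ⟨ΩC, TC, AC, DC, ρC, hC⟩ := h.hCov
  exact ⟨⟨ΩΓ, fun ω σ u => TΓ ω σ (r u), SXΓ, AΓ, DΓ, ρΓ, jointWalkExpansion_comp_clm hΓ r hr⟩,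
    ⟨ΩE, fun ω σ u => TE ω σ (r u), SXE, AE, DE, ρE, jointWalkExpansion_comp_clm hE r hr⟩,
    ⟨ΩC, fun ω σ u => TC ω σ (r u), AC, DC, ρC, walkMajorants_comp_clm hC r hr⟩,
    fun b z hz => h.hfar b z hz⟩

/-- **Along a contraction the package is unchanged**: `TermWalkData 𝒦 w ⟹ TermWalkData (pullback 𝒦 r) w` for `‖r‖ ≤ 1`.
[cite: Balaban1988RG2Cluster, p.13, p.15; Balaban1985BackgroundPropagators, Thm 3.10 p.416] -/
theorem termWalkData_pullback_of_opNorm_le {𝒦 : TermKernels c d N' ν Nf V} {w : WalkConsts} (h : TermWalkData 𝒦 w)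
    (r : W →L[ℂ] V) (hr : ‖r‖ ≤ 1) : TermWalkData (pullback 𝒦 r) w :=
  termWalkData_pullback h r (mapsTo_ball_of_opNorm_le r hr le_rfl)

/-- **A member assembled term by term from window-space data with ONE package keeps that package**: if every term `i`
of a member has kernel data `𝒦V i` on its own window space `V i` carrying `TermWalkData (𝒦V i) w` for one admissible `w`,
then the member `i ↦ pullback (𝒦V i) (r i)` along contractions `r i` carries `ExistsWalkDataUniform` with the same `w` —
the uniform statement (v) of `B13TermWalkData` is insensitive to the pullback. [cite: Balaban1988RG2Cluster, p.13, p.15; Balaban1985BackgroundPropagators, Thm 3.10 p.416] -/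
theorem existsWalkDataUniform_pullback {ι : Type*} {Vi : ι → Type*} [∀ i, NormedAddCommGroup (Vi i)]
    [∀ i, NormedSpace ℂ (Vi i)] (𝒦V : ∀ i, TermKernels c d N' ν Nf (Vi i)) (r : ∀ i, W →L[ℂ] Vi i)
    (hr : ∀ i, ‖r i‖ ≤ 1) {w : WalkConsts} {α Rσ₀ : ℝ} (hw : w.Admissible α Rσ₀)
    (h : ∀ i, TermWalkData (𝒦V i) w) :
    ExistsWalkDataUniform (fun i => pullback (𝒦V i) (r i)) α Rσ₀ :=
  ⟨w, hw, fun i => termWalkData_pullback_of_opNorm_le (h i) (r i) (hr i)⟩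

/-- **The jet record pulls back along a contraction with the SAME letters** (`κ, K_Γ, K₀, θ_Γ, θ_E, K₁, K₂`, `K₁, K₂ ≥ 0`):
the reference letters and the σ-differences at the base configuration are those of `𝒦` (`r 0 = 0`); the germ transports
(§2 `analyticOnBall_comp_clm`); the first-derivative letters by the chain rule `D(g ∘ r)(0)[v] = Dg(0)[r v]` and
`‖r v‖ ≤ ‖v‖`; the second-derivative letters by `∂²(g ∘ r)(v,w) = ∂²g(r v, r w)`
(`Beta.RemainderLocality.mixedDeriv_comp_clm`). [cite: Balaban1988RG2Cluster, (2.16) p.16, p.15; Balaban1987RG1, (4.3)–(4.5) pp.281–282] -/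
theorem jet216R_pullback {𝒦 : TermKernels c d N' ν Nf V} {kap KΓ K₀ θΓ θE K₁ K₂ : ℝ}
    (h : Jet216R 𝒦 kap KΓ K₀ θΓ θE K₁ K₂) (hK₁ : 0 ≤ K₁) (hK₂ : 0 ≤ K₂) (r : W →L[ℂ] V) (hr : ‖r‖ ≤ 1) :
    Jet216R (pullback 𝒦 r) kap KΓ K₀ θΓ θE K₁ K₂ := by
  obtain ⟨ρ₀, hρ₀, hgE, hgΓ⟩ := h.germ
  have hmaps : MapsTo r (ball (0 : W) ρ₀) (ball (0 : V) ρ₀) := mapsTo_ball_of_opNorm_le r hr le_rfl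
  have hru : ∀ u : W, ‖r u‖ ≤ ‖u‖ := norm_apply_le_of_opNorm_le r hr
  -- chain rules for one entry `g` holomorphic on the `ρ₀`-ball of `V`
  have hfd : ∀ {g : V → ℂ}, DifferentiableOn ℂ g (ball (0 : V) ρ₀) → ∀ v : W,
      fderiv ℂ (fun u : W => g (r u)) 0 v = fderiv ℂ g 0 (r v) := by
    intro g hg v
    have h0 : DifferentiableAt ℂ g (r 0) := by
      rw [map_zero]; exact hg.differentiableAt (isOpen_ball.mem_nhds (mem_ball_self hρ₀))
    rw [show (fun u : W => g (r u)) = g ∘ r from rfl, fderiv_comp 0 h0 r.differentiableAt,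
      ContinuousLinearMap.fderiv, ContinuousLinearMap.comp_apply, map_zero]
  have hmd : ∀ {g : V → ℂ}, DifferentiableOn ℂ g (ball (0 : V) ρ₀) → ∀ v w : W,
      mixedDeriv (fun u : W => g (r u)) v w = mixedDeriv g (r v) (r w) := by
    intro g hg v w
    exact mixedDeriv_comp_clm hρ₀ (fun y hy => hg.differentiableAt (isOpen_ball.mem_nhds hy)) r v w
  refine ⟨h.refΓ, h.refC, fun σ hσ b j => ?_, fun σ hσ b b' => ?_,
    ⟨ρ₀, hρ₀, analyticOnBall_comp_clm hgE r hmaps, analyticOnBall_comp_clm hgΓ r hmaps⟩,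
    fun σ hσ b j v => ?_, fun σ hσ b j v w => ?_, fun σ hσ b b' v => ?_, fun σ hσ b b' v w => ?_⟩
  · show ‖(𝒦.G2 σ (r 0) - 𝒦.Γ₀.map (algebraMap ℝ ℂ)) b j‖ ≤ _
    rw [map_zero]; exact h.dΓ0 σ hσ b j
  · show ‖(𝒦.A2 σ (r 0) - 𝒦.C⁻¹.map (algebraMap ℝ ℂ)) b b'‖ ≤ _
    rw [map_zero]; exact h.dE0 σ hσ b b'
  · show ‖fderiv ℂ (fun u : W => 𝒦.G2 σ (r u) b j) 0 v‖ ≤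
      K₁ * Real.exp (-(kap * tdist1 Nf (𝒦.locΛ b) (𝒦.locN j))) * ‖v‖
    rw [hfd (hgΓ σ hσ b j)]
    exact (h.d1Γ σ hσ b j (r v)).trans
      (mul_le_mul_of_nonneg_left (hru v) (mul_nonneg hK₁ (Real.exp_pos _).le))
  · show ‖mixedDeriv (fun u : W => 𝒦.G2 σ (r u) b j) v w‖ ≤
      K₂ * Real.exp (-(kap * tdist1 Nf (𝒦.locΛ b) (𝒦.locN j))) * ‖v‖ * ‖w‖
    rw [hmd (hgΓ σ hσ b j)]
    have h2 := h.d2Γ σ hσ b j (r v) (r w)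
    have hK : 0 ≤ K₂ * Real.exp (-(kap * tdist1 Nf (𝒦.locΛ b) (𝒦.locN j))) :=
      mul_nonneg hK₂ (Real.exp_pos _).le
    exact h2.trans (mul_le_mul (mul_le_mul_of_nonneg_left (hru v) hK) (hru w) (norm_nonneg _)
      (mul_nonneg hK (norm_nonneg _)))
  · show ‖fderiv ℂ (fun u : W => 𝒦.A2 σ (r u) b b') 0 v‖ ≤
      K₁ * Real.exp (-(kap * tdist1 Nf (𝒦.locΛ b) (𝒦.locΛ b'))) * ‖v‖
    rw [hfd (hgE σ hσ b b')]
    exact (h.d1E σ hσ b b' (r v)).trans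
      (mul_le_mul_of_nonneg_left (hru v) (mul_nonneg hK₁ (Real.exp_pos _).le))
  · show ‖mixedDeriv (fun u : W => 𝒦.A2 σ (r u) b b') v w‖ ≤
      K₂ * Real.exp (-(kap * tdist1 Nf (𝒦.locΛ b) (𝒦.locΛ b'))) * ‖v‖ * ‖w‖
    rw [hmd (hgE σ hσ b b')]
    have h2 := h.d2E σ hσ b b' (r v) (r w)
    have hK : 0 ≤ K₂ * Real.exp (-(kap * tdist1 Nf (𝒦.locΛ b) (𝒦.locΛ b'))) :=
      mul_nonneg hK₂ (Real.exp_pos _).le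
    exact h2.trans (mul_le_mul (mul_le_mul_of_nonneg_left (hru v) hK) (hru w) (norm_nonneg _)
      (mul_nonneg hK (norm_nonneg _)))

end Transport

/-! ## §3 (r2) for pullback families: the three hypotheses of `B13JetFamilyLocality` discharged from walk data on `V` -/

section EntryLocal

/-- **`hEr` from analyticity on the window space**: every entry `v ↦ (entries 𝒦 σ v) i` is complex differentiable on
the `R`-ball when the precision and the Γ-kernel are (`AnalyticOnBall`, σ in the polydisc). [cite: Balaban1988RG2Cluster, p.15] -/
theorem differentiableOn_entries {𝒦 : TermKernels c d N' ν Nf V} {R : ℝ}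
    (haE : JointWalkExpansion.AnalyticOnBall c 𝒦.A2 R) (haΓ : JointWalkExpansion.AnalyticOnBall c 𝒦.G2 R)
    {σ : TPt d N' → ℂ} (hσ : ∀ j, ‖σ j‖ ≤ Real.exp c.κ₁) :
    ∀ i, DifferentiableOn ℂ (fun v => entries 𝒦 σ v i) (ball 0 R) := by
  rintro (⟨b, j⟩ | ⟨b, b'⟩)
  · exact haΓ σ hσ b j
  · exact haE σ hσ b b'

/-- **`hbd` from the torus majorants**: `‖(entries 𝒦 σ v) i‖ ≤ max K̄_Γ K̄_E` on the ball when
`‖G(σ,v)(b,j)‖ ≤ K̄_Γe^{−κd₁}`, `‖A(σ,v)(b,b′)‖ ≤ K̄_Ee^{−κd₁}` there (`κ ≥ 0`, `K̄ ≥ 0`: `e^{−κd₁} ≤ 1`). [cite: Balaban1988RG2Cluster, p.15, (1.11) p.5] -/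
theorem norm_entries_le {𝒦 : TermKernels c d N' ν Nf V} {R kap KΓ KE : ℝ}
    (hkap : 0 ≤ kap) (hKΓ : 0 ≤ KΓ) (hKE : 0 ≤ KE)
    (hmΓ : ∀ σ : TPt d N' → ℂ, (∀ j, ‖σ j‖ ≤ Real.exp c.κ₁) → ∀ u ∈ ball (0 : V) R,
      ∀ b j, ‖𝒦.G2 σ u b j‖ ≤ KΓ * Real.exp (-(kap * tdist1 Nf (𝒦.locΛ b) (𝒦.locN j))))
    (hmE : ∀ σ : TPt d N' → ℂ, (∀ j, ‖σ j‖ ≤ Real.exp c.κ₁) → ∀ u ∈ ball (0 : V) R,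
      ∀ b b', ‖𝒦.A2 σ u b b'‖ ≤ KE * Real.exp (-(kap * tdist1 Nf (𝒦.locΛ b) (𝒦.locΛ b'))))
    {σ : TPt d N' → ℂ} (hσ : ∀ j, ‖σ j‖ ≤ Real.exp c.κ₁) :
    ∀ i, ∀ v ∈ ball (0 : V) R, ‖entries 𝒦 σ v i‖ ≤ max KΓ KE := by
  have hexp : ∀ a b : UT Nf, Real.exp (-(kap * tdist1 Nf a b)) ≤ 1 := fun a b =>
    Real.exp_le_one_iff.2 (neg_nonpos.2 (mul_nonneg hkap (tdist1_nonneg a b)))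
  rintro (⟨b, j⟩ | ⟨b, b'⟩) v hv
  · calc ‖𝒦.G2 σ v b j‖ ≤ KΓ * Real.exp (-(kap * tdist1 Nf (𝒦.locΛ b) (𝒦.locN j))) := hmΓ σ hσ v hv b j
      _ ≤ KΓ * 1 := mul_le_mul_of_nonneg_left (hexp _ _) hKΓ
      _ ≤ max KΓ KE := by rw [mul_one]; exact le_max_left _ _
  · calc ‖𝒦.A2 σ v b b'‖ ≤ KE * Real.exp (-(kap * tdist1 Nf (𝒦.locΛ b) (𝒦.locΛ b'))) := hmE σ hσ v hv b b'
      _ ≤ KE * 1 := mul_le_mul_of_nonneg_left (hexp _ _) hKE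
      _ ≤ max KΓ KE := by rw [mul_one]; exact le_max_right _ _

/-- `hEr` from the term's walk objects on the window space (the germ radius IS the package's `R`).
[cite: Balaban1988RG2Cluster, p.13, p.15; Balaban1985BackgroundPropagators, Thm 3.10 p.416] -/
theorem termWalkData_differentiableOn_entries {𝒦 : TermKernels c d N' ν Nf V} {w : WalkConsts}
    (h : TermWalkData 𝒦 w) (hε : 0 ≤ w.ε) {σ : TPt d N' → ℂ} (hσ : ∀ j, ‖σ j‖ ≤ Real.exp c.κ₁) :
    ∀ i, DifferentiableOn ℂ (fun v => entries 𝒦 σ v i) (ball 0 w.R) := by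
  obtain ⟨ΩΓ, TΓ, SXΓ, AΓ, DΓ, ρΓ, hΓ⟩ := h.hΓ
  obtain ⟨ΩE, TE, SXE, AE, DE, ρE, hE⟩ := h.hE
  exact differentiableOn_entries (hE.analyticOnBall hε) (hΓ.analyticOnBall hε) hσ

/-- `hbd` from the term's walk objects on the window space, `S = max K̄_Γ K̄_E`.
[cite: Balaban1988RG2Cluster, p.13, p.15; Balaban1985BackgroundPropagators, Thm 3.10 p.416] -/
theorem termWalkData_norm_entries_le {𝒦 : TermKernels c d N' ν Nf V} {w : WalkConsts} (h : TermWalkData 𝒦 w)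
    (hε : 0 ≤ w.ε) (hkap : 0 ≤ w.kap) (hKΓ : 0 ≤ w.KbarΓ) (hKE : 0 ≤ w.KbarE)
    {σ : TPt d N' → ℂ} (hσ : ∀ j, ‖σ j‖ ≤ Real.exp c.κ₁) :
    ∀ i, ∀ v ∈ ball (0 : V) w.R, ‖entries 𝒦 σ v i‖ ≤ max w.KbarΓ w.KbarE := by
  obtain ⟨ΩΓ, TΓ, SXΓ, AΓ, DΓ, ρΓ, hΓ⟩ := h.hΓ
  obtain ⟨ΩE, TE, SXE, AE, DE, ρE, hE⟩ := h.hE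
  exact norm_entries_le hkap hKΓ hKE (hΓ.majorants hε) (hE.majorants hε) hσ

/-- **(r2) ENTRY-LEVEL (1.7)-LOCALITY HOLDS BY CONSTRUCTION FOR A PULLBACK FAMILY.**  If a term's kernel data `𝒦` on
the window space `V` carry the three walk objects with one package `w` (`ε, κ, K̄_Γ, K̄_E ≥ 0`), then for every
`r : W →L[ℂ] V` and every `σ` in the polydisc the pullback family satisfies the three hypotheses of
`B13JetFamilyLocality` with `Er := entries 𝒦 σ`, `ρ′ := w.R`, `S := max K̄_Γ K̄_E`, and `hfac` on the WHOLE configuration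
space: `∃ Er, (∀ i, DifferentiableOn ℂ (Er · i) (ball 0 w.R)) ∧ (∀ i, ∀ v ∈ ball 0 w.R, ‖Er v i‖ ≤ S) ∧
∀ u, entries (pullback 𝒦 r) σ u = Er (r u)` — in particular the ideation cell's `EntryLocal (pullback 𝒦 r) σ r ρ w.R S`
for EVERY `ρ`.  For Bałaban's operators the HYPOTHESIS (walk data on the window space) is NODE O's content, not
asserted. [cite: Balaban1987RG1, (1.7) p.261, (1.18) p.263; Balaban1988RG2Cluster, p.13, p.15, (2.14)–(2.16) pp.15–16; Balaban1985BackgroundPropagators, Thm 3.10 p.416] -/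
theorem entryLocal_pullback {𝒦 : TermKernels c d N' ν Nf V} {w : WalkConsts} (h : TermWalkData 𝒦 w)
    (hε : 0 ≤ w.ε) (hkap : 0 ≤ w.kap) (hKΓ : 0 ≤ w.KbarΓ) (hKE : 0 ≤ w.KbarE) (r : W →L[ℂ] V)
    {σ : TPt d N' → ℂ} (hσ : ∀ j, ‖σ j‖ ≤ Real.exp c.κ₁) :
    ∃ Er : V → ((𝒦.Λ × (𝒦.Λ ⊕ 𝒦.C₀)) ⊕ (𝒦.Λ × 𝒦.Λ)) → ℂ,
      (∀ i, DifferentiableOn ℂ (fun v => Er v i) (ball 0 w.R)) ∧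
      (∀ i, ∀ v ∈ ball (0 : V) w.R, ‖Er v i‖ ≤ max w.KbarΓ w.KbarE) ∧
      ∀ u : W, entries (pullback 𝒦 r) σ u = Er (r u) :=
  ⟨entries 𝒦 σ, termWalkData_differentiableOn_entries h hε hσ, termWalkData_norm_entries_le h hε hkap hKΓ hKE hσ,
    fun u => entries_pullback 𝒦 r σ u⟩

/-- **(r2) for a pullback family from an ADMISSIBLE package** (the signs are part of admissibility).
[cite: Balaban1987RG1, (1.7) p.261; Balaban1988RG2Cluster, p.13, p.15; Balaban1985BackgroundPropagators, Thm 3.10 p.416] -/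
theorem entryLocal_pullback_of_admissible {𝒦 : TermKernels c d N' ν Nf V} {w : WalkConsts} {α Rσ₀ : ℝ}
    (hw : w.Admissible α Rσ₀) (h : TermWalkData 𝒦 w) (r : W →L[ℂ] V)
    {σ : TPt d N' → ℂ} (hσ : ∀ j, ‖σ j‖ ≤ Real.exp c.κ₁) :
    ∃ Er : V → ((𝒦.Λ × (𝒦.Λ ⊕ 𝒦.C₀)) ⊕ (𝒦.Λ × 𝒦.Λ)) → ℂ,
      (∀ i, DifferentiableOn ℂ (fun v => Er v i) (ball 0 w.R)) ∧
      (∀ i, ∀ v ∈ ball (0 : V) w.R, ‖Er v i‖ ≤ max w.KbarΓ w.KbarE) ∧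
      ∀ u : W, entries (pullback 𝒦 r) σ u = Er (r u) :=
  entryLocal_pullback h hw.hε hw.hkap.le hw.hKbarΓ hw.hKbarE r hσ

end EntryLocal

/-! ## §4 Consequences BY NAME: the jet lift commutes with the pullback; the wall shapes with no locality hypothesis -/

section Consequences

/-- **The jet family's entries ARE the second-order Taylor polynomials of the entries** (definitional unfolding of
`kjet` and `entries`). [cite: Balaban1988RG2Cluster, (2.14)–(2.16) pp.15–16; Balaban1987RG1, (4.3) p.281] -/
theorem entries_kjet_eq_jet2 {E : Type*} [NormedAddCommGroup E] [NormedSpace ℂ E] (𝒦 : TermKernels c d N' ν Nf E)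
    (σ : TPt d N' → ℂ) :
    entries (kjet 𝒦) σ = fun v i => jet2 (fun v' => entries 𝒦 σ v' i) v := by
  funext v i
  rcases i with ⟨b, j⟩ | ⟨b, b'⟩
  · rfl
  · rfl

/-- **THE JET LIFT COMMUTES WITH THE PULLBACK on the polydisc**: `entries (kjet (pullback 𝒦 r)) σ u =
entries (kjet 𝒦) σ (r u)` for EVERY `u : W`, as soon as the window-space entries are holomorphic on some ball
(`B13JetFamilyLocality.entries_kjet_fac` with `Er := entries 𝒦 σ` and `hfac := rfl`: the second-order Taylor polynomial
of `g ∘ r` is that of `g` composed with `r`). [cite: Balaban1987RG1, (4.3) p.281, (1.7) p.261; Balaban1988RG2Cluster, (2.14)–(2.16) pp.15–16] -/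
theorem entries_kjet_pullback {𝒦 : TermKernels c d N' ν Nf V} {R : ℝ} (hR : 0 < R)
    (haE : JointWalkExpansion.AnalyticOnBall c 𝒦.A2 R) (haΓ : JointWalkExpansion.AnalyticOnBall c 𝒦.G2 R)
    (r : W →L[ℂ] V) {σ : TPt d N' → ℂ} (hσ : ∀ j, ‖σ j‖ ≤ Real.exp c.κ₁) (u : W) :
    entries (kjet (pullback 𝒦 r)) σ u = entries (kjet 𝒦) σ (r u) := by
  rw [entries_kjet_eq_jet2 𝒦 σ]
  exact entries_kjet_fac (pullback 𝒦 r) σ r hR hR (Er := entries 𝒦 σ) (differentiableOn_entries haE haΓ hσ)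
    (fun u' _ => entries_pullback 𝒦 r σ u') u

/-- **Every jet object of a pullback family factors through `r` EVERYWHERE, with local factor the SAME object on the
window space's jet family** — the `hfac` shape of `Beta.RemainderLocality.PolLeavesTFac` with no locality hypothesis.
[cite: Balaban1987RG1, (1.7) p.261, (1.18) p.263; Balaban1988RG2Cluster, (2.14)–(2.16) pp.15–16] -/
theorem jet_object_fac_pullback {𝒦 : TermKernels c d N' ν Nf V} {R : ℝ} (hR : 0 < R)
    (haE : JointWalkExpansion.AnalyticOnBall c 𝒦.A2 R) (haΓ : JointWalkExpansion.AnalyticOnBall c 𝒦.G2 R)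
    (r : W →L[ℂ] V) {σ : TPt d N' → ℂ} (hσ : ∀ j, ‖σ j‖ ≤ Real.exp c.κ₁)
    {T : Type*} (Φ : (((𝒦.Λ × (𝒦.Λ ⊕ 𝒦.C₀)) ⊕ (𝒦.Λ × 𝒦.Λ)) → ℂ) → T) (u : W) :
    Φ (entries (kjet (pullback 𝒦 r)) σ u) = (Φ ∘ entries (kjet 𝒦) σ) (r u) := by
  rw [entries_kjet_pullback hR haE haΓ r hσ u]; rfl

/-- **The TRUE object of a pullback family factors through `r` everywhere** (definitional) — the same datum serves the
true-object road on the whole space, not only on a ball. [cite: Balaban1987RG1, (1.7) p.261] -/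
theorem trueObject_fac_pullback (𝒦 : TermKernels c d N' ν Nf V) (r : W →L[ℂ] V) (σ : TPt d N' → ℂ)
    {T : Type*} (Φ : (((𝒦.Λ × (𝒦.Λ ⊕ 𝒦.C₀)) ⊕ (𝒦.Λ × 𝒦.Λ)) → ℂ) → T) (u : W) :
    Φ (entries (pullback 𝒦 r) σ u) = (Φ ∘ entries 𝒦 σ) (r u) := rfl

/-- **The local factor is ANALYTIC at `0` on a finite-dimensional window space** — the `hF` shape of
`Beta.RemainderLocality.PolLeavesTFac` — for `Φ` holomorphic on an open set containing the base entries, from the walk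
objects on the window space (`B13JetFamilyLocality.analyticAt_jetFactor`, Osgood by name). [cite: Balaban1987RG1, (1.18) p.263, (4.3)–(4.5) pp.281–282; HormanderSCV1973, Thm 2.2.1 and Thm 2.2.6] -/
theorem analyticAt_jetFactor_pullback [FiniteDimensional ℂ V] {𝒦 : TermKernels c d N' ν Nf V} [Fintype 𝒦.C₀]
    {w : WalkConsts} (h : TermWalkData 𝒦 w) (hR : 0 < w.R)
    (hε : 0 ≤ w.ε) (hkap : 0 ≤ w.kap) (hKΓ : 0 ≤ w.KbarΓ) (hKE : 0 ≤ w.KbarE)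
    {σ : TPt d N' → ℂ} (hσ : ∀ j, ‖σ j‖ ≤ Real.exp c.κ₁)
    {T : Type*} [NormedAddCommGroup T] [NormedSpace ℂ T] [CompleteSpace T]
    {Φ : (((𝒦.Λ × (𝒦.Λ ⊕ 𝒦.C₀)) ⊕ (𝒦.Λ × 𝒦.Λ)) → ℂ) → T}
    {U : Set (((𝒦.Λ × (𝒦.Λ ⊕ 𝒦.C₀)) ⊕ (𝒦.Λ × 𝒦.Λ)) → ℂ)} (hU : IsOpen U) (hΦ : DifferentiableOn ℂ Φ U)
    (h0 : entries 𝒦 σ 0 ∈ U) :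
    AnalyticAt ℂ (Φ ∘ entries (kjet 𝒦) σ) 0 := by
  rw [entries_kjet_eq_jet2 𝒦 σ]
  exact analyticAt_jetFactor hR (termWalkData_differentiableOn_entries h hε hσ)
    (termWalkData_norm_entries_le h hε hkap hKΓ hKE hσ) hU hΦ h0

/-- **THE (D4) WALL'S `hfac` ∕ `hF` SHAPES FOR EVERY JET OBJECT OF A PULLBACK FAMILY, WITH NO LOCALITY HYPOTHESIS**:
from the three walk objects of the term ON THE WINDOW SPACE with one admissible package, for every contraction-free
`r : W →L[ℂ] V`, every `σ` in the polydisc and every `Φ` holomorphic on an open set containing the base entries (the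
window space finite-dimensional, the target complete), `∃ F, AnalyticAt ℂ F 0 ∧ ∀ u, Φ (entries (kjet (pullback 𝒦 r)) σ u)
= F (r u)` — the conclusion of the ideation cell's `wallShapes_of_entryLocal` (P3 n°36) with its hypothesis `EntryLocal`
replaced by the walk data the «W-walks» rung asks, on `V`.  The witness is `F = Φ ∘ entries (kjet 𝒦) σ`.
[cite: Balaban1987RG1, (1.7) p.261, (1.18) p.263, (4.3)–(4.5) pp.281–282; Balaban1988RG2Cluster, p.13, p.15, (2.14)–(2.16) pp.15–16; Balaban1985BackgroundPropagators, Thm 3.10 p.416] -/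
theorem wallShapes_pullback [FiniteDimensional ℂ V] {𝒦 : TermKernels c d N' ν Nf V} [Fintype 𝒦.C₀]
    {w : WalkConsts} {α Rσ₀ : ℝ} (hw : w.Admissible α Rσ₀) (hα : 0 ≤ α) (h : TermWalkData 𝒦 w)
    (r : W →L[ℂ] V) {σ : TPt d N' → ℂ} (hσ : ∀ j, ‖σ j‖ ≤ Real.exp c.κ₁)
    {T : Type*} [NormedAddCommGroup T] [NormedSpace ℂ T] [CompleteSpace T]
    {Φ : (((𝒦.Λ × (𝒦.Λ ⊕ 𝒦.C₀)) ⊕ (𝒦.Λ × 𝒦.Λ)) → ℂ) → T}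
    {U : Set (((𝒦.Λ × (𝒦.Λ ⊕ 𝒦.C₀)) ⊕ (𝒦.Λ × 𝒦.Λ)) → ℂ)} (hU : IsOpen U) (hΦ : DifferentiableOn ℂ Φ U)
    (h0 : entries 𝒦 σ 0 ∈ U) :
    ∃ F : V → T, AnalyticAt ℂ F 0 ∧ ∀ u : W, Φ (entries (kjet (pullback 𝒦 r)) σ u) = F (r u) := by
  have hR : 0 < w.R := hα.trans_lt hw.hαR
  obtain ⟨ΩΓ, TΓ, SXΓ, AΓ, DΓ, ρΓ, hΓ⟩ := h.hΓ
  obtain ⟨ΩE, TE, SXE, AE, DE, ρE, hE⟩ := h.hE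
  exact ⟨Φ ∘ entries (kjet 𝒦) σ,
    analyticAt_jetFactor_pullback h hR hw.hε hw.hkap.le hw.hKbarΓ hw.hKbarE hσ hU hΦ h0,
    fun u => jet_object_fac_pullback hR (hE.analyticOnBall hw.hε) (hΓ.analyticOnBall hw.hε) r hσ Φ u⟩

end Consequences

end Literature.MathematicalPhysics.QuantumFieldTheory.Balaban1983to89.B13TermKernelsPullback

end
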